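import Mathlib
import Summits.Ventures.PercRepro2.HCov
import Summits.Ventures.PercRepro2.Graph
import Summits.Ventures.PercRepro2.RestrictClosure
import Summits.Ventures.PercRepro2.RECMReduction
import Summits.Ventures.PercRepro2.CCWReduced
import Summits.Ventures.PercRepro2.A3Reduction
import Summits.Ventures.PercRepro2.CutVertexPaths
import Summits.Ventures.PercRepro2.PocketSign
import Summits.Ventures.PercRepro2.SepTwoGcZero
import Summits.Ventures.PercRepro2.SepThreeGcZero
import Summits.Ventures.PercRepro2.CycleNecklace
import Summits.Ventures.PercRepro2.BlockSubstClass
import Summits.Ventures.PercRepro2.SevenClass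
import Summits.Ventures.PercRepro2.IsolatedMark
import Summits.Ventures.PercRepro2.GcSkelRules
import Summits.Ventures.PercRepro2.GcSkelReduction
import Summits.Ventures.PercRepro2.GcSkelReductionS
import Summits.Ventures.PercRepro2.GcSkelReductionC
import Summits.Ventures.PercRepro2.GcSkelReductionR
import Summits.Ventures.PercRepro2.GcSkelReductionN
import Summits.Ventures.PercRepro2.GcSkelReductionB
import Summits.Ventures.PercRepro2.GcSkelReductionSeven
import Summits.Ventures.PercRepro2.GcSkelReductionP
import Summits.Ventures.PercRepro2.GcSkelReductionI
import Summits.Ventures.PercRepro2.GcSkelCutShape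
import Summits.Ventures.PercRepro2.GcSkelCutShapeMain
import Summits.Ventures.PercRepro2.GcSkelMarksConn
import Summits.Ventures.PercRepro2.GcSkelTwoConnected

/-!
# The weighted residual, characterised without cut vertices (blind cell PercRepro2, typer-1 g53)

The three cut-vertex clauses of `WRed.WReducedC` (`prune`, `oneFar`, `twoThree`) quantify over every
cut-vertex decomposition. On the residual they are EQUIVALENT to one finite connectivity condition:
**`WhitneyOff ends a₃`** — for every vertex `v`, any two non-isolated vertices other than `v` and `a₃`
are connected in `G − v` (`SepPair.sepConfig ends {v}`). `conn_sepConfig_of_wredI` gives it on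
`WReducedI`; conversely, with the other clauses, it gives the three cut clauses
(`prune_of_whitney`, `oneFar_of_whitney`, `twoThree_of_whitney`): the component of a left vertex in
`G − v` stays on the left (`mem_left_of_conn_sepConfig`), so no non-isolated vertex other than `a₃`
is on the left once a non-isolated mark other than `a₃` is on the right (`not_left_of_whitney`).

**`WReducedW`** := the residual's clauses with `WhitneyOff` in place of the cut clauses. This file:
the definition, the two key lemmas, and `prune` / `oneFar` from `WhitneyOff`; `twoThree` and the
equivalence **`wredI_iff_wredW`** are `GcSkelWhitneyMain.lean`.
-/

namespace Summit.Ventures.PercRepro2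

open CovForm RECM CutVertexM9 SepPair

namespace WRed

section Whitney

variable {V : Type*} {E : Type*}

/-- **Two-connectivity off `a₃`**: for every vertex `v`, two non-isolated vertices other than `v`
and `a₃` are connected in `G − v`. -/
def WhitneyOff (ends : E → Sym2 V) (a₃ : V) : Prop :=
  ∀ v x y : V, x ≠ v → y ≠ v → x ≠ a₃ → y ≠ a₃ → (∃ e, x ∈ ends e ∧ ¬ (ends e).IsDiag) →
    (∃ e, y ∈ ends e ∧ ¬ (ends e).IsDiag) → Conn ends (sepConfig ends {v}) x y

/-- The component of a left vertex in `G − v` stays on the left. -/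
lemma mem_left_of_conn_sepConfig {ends : E → Sym2 V} {side : E → Bool} {L : Set V} {v : V}
    {Rt : Set V} (hcut : CutVertex ends side L v Rt) {x y : V} (hx : x ∈ L)
    (h : Conn ends (sepConfig ends {v}) x y) : y ∈ L := by
  refine mem_of_conn_of_closed (S := L) ?_ hx h
  intro z hz w hadj
  rw [openGraph_adj] at hadj
  obtain ⟨-, e, he, hends⟩ := hadj
  have hnot := not_mem_of_not_mem_touches hends (not_mem_touches_of_sepConfig he)
  cases hs : side e with
  | true =>
    rcases hcut.left e hs w (by rw [hends]; exact Sym2.mem_mk_right _ _) with hw | hw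
    · exact hw
    · exact absurd (Set.mem_singleton_iff.2 hw) hnot.2
  | false =>
    rcases hcut.right e hs z (by rw [hends]; exact Sym2.mem_mk_left _ _) with hz' | hz'
    · exact absurd hz' (hcut.disj z hz)
    · exact absurd (Set.mem_singleton_iff.2 hz') hnot.1

/-- **Under `WhitneyOff`, no non-isolated vertex other than `a₃` is on the left once a non-isolated
vertex other than `a₃` is on the right.** -/
lemma not_left_of_whitney {ends : E → Sym2 V} {a₃ : V} (hW : WhitneyOff ends a₃) {side : E → Bool}
    {L : Set V} {v : V} {Rt : Set V} (hcut : CutVertex ends side L v Rt) {x m : V} (hm : m ∈ Rt)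
    (hm3 : m ≠ a₃) (hmE : ∃ e, m ∈ ends e ∧ ¬ (ends e).IsDiag) (hx3 : x ≠ a₃)
    (hxE : ∃ e, x ∈ ends e ∧ ¬ (ends e).IsDiag) (hx : x ∈ L) : False := by
  have hxv : x ≠ v := fun h => hcut.vL (h ▸ hx)
  have hmv : m ≠ v := fun h => hcut.vR (h ▸ hm)
  exact hcut.disj m (mem_left_of_conn_sepConfig hcut hx (hW v x m hxv hmv hx3 hm3 hxE hmE)) hm

/-- A non-loop edge of the left side has an end on the left, not `v`. -/
lemma exists_left_end {ends : E → Sym2 V} {side : E → Bool} {L : Set V} {v : V} {Rt : Set V}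
    (hcut : CutVertex ends side L v Rt) {g : E} (hg : side g = true) (hd : ¬ (ends g).IsDiag) :
    ∃ x y : V, ends g = s(x, y) ∧ x ∈ L ∧ (y ∈ L ∨ y = v) := by
  obtain ⟨x, y, hxy⟩ : ∃ x y, ends g = s(x, y) :=
    (Sym2.exists (f := fun t => ends g = t)).1 ⟨ends g, rfl⟩
  have hne : x ≠ y := by
    rw [hxy, Sym2.mk_isDiag_iff] at hd
    exact hd
  have hx := hcut.left g hg x (by rw [hxy]; exact Sym2.mem_mk_left _ _)
  have hy := hcut.left g hg y (by rw [hxy]; exact Sym2.mem_mk_right _ _)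
  rcases hx with hxL | hxv
  · exact ⟨x, y, hxy, hxL, hy⟩
  · rcases hy with hyL | hyv
    · exact ⟨y, x, by rw [hxy, Sym2.eq_swap], hyL, Or.inr hxv⟩
    · exact absurd (hxv.trans hyv.symm) hne

end Whitney

section Class

variable {V : Type*} {E : Type*} [Fintype E] [DecidableEq V]

/-- **The residual without cut-vertex clauses**: `WReducedI`'s clauses with `WhitneyOff` in place of
`prune` / `oneFar` / `twoThree` (the pendant-root clauses `leaf_a1` / `leaf_a2` are implied by
`deg_a1` / `deg_a2` and omitted). -/
structure WReducedW (ends : E → Sym2 V) (o a₁ a₂ a₃ b : V) : Prop where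
  /-- no two parallel non-loop edges -/
  simple : Simple ends
  /-- no unmarked leaf, no unmarked series vertex -/
  unmarked : ∀ y, Unmarked o a₁ a₂ a₃ b y → nonLoopDeg ends y ≠ 1 ∧ nonLoopDeg ends y ≠ 2
  /-- `o` is not a leaf -/
  deg_o : nonLoopDeg ends o ≠ 1
  /-- `b` is not a leaf -/
  deg_b : nonLoopDeg ends b ≠ 1
  /-- `a₁` is not a leaf -/
  deg_a1 : nonLoopDeg ends a₁ ≠ 1
  /-- `a₂` is not a leaf -/
  deg_a2 : nonLoopDeg ends a₂ ≠ 1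
  /-- a pendant `a₃` hangs at an unmarked vertex -/
  leaf_a3 : ∀ (e : E) (x : V), ends e = s(x, a₃) → x ≠ a₃ → nonLoopDeg ends a₃ = 1 →
    Unmarked o a₁ a₂ a₃ b x
  /-- not class R -/
  notR : ¬ RootsToMarks ends o a₁ a₂ a₃ b
  /-- not class R₃ -/
  notR3 : ¬ A3RECM.A3ToMarks ends o a₁ a₂ a₃ b
  /-- no root-only pocket contains `a₃` without `o`, `b` -/
  noPocket : ∀ P : Finset V, PocketConn.IsPocket ends (↑P : Set V) a₁ a₂ → a₃ ∈ P → a₁ ∉ P →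
    a₂ ∉ P → o ∉ P → b ∈ P
  /-- `b` is reached from `o` in `G − {a₁, a₂}` -/
  sep2 : b ∈ cluster ends (sepConfig ends {a₁, a₂}) o
  /-- `{a₁, a₃}` does not cut `o` off from both `a₂` and `b` -/
  sep3 : a₂ ∉ cluster ends (sepConfig ends {a₁, a₃}) o ∪ {a₁, a₃} →
    b ∈ cluster ends (sepConfig ends {a₁, a₃}) o
  /-- `{a₂, a₃}` does not cut `o` off from both `a₁` and `b` -/
  sep3' : a₁ ∉ cluster ends (sepConfig ends {a₂, a₃}) o ∪ {a₂, a₃} →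
    b ∈ cluster ends (sepConfig ends {a₂, a₃}) o
  /-- the marks are not the terminals of a necklace -/
  noNecklace : ∀ (q : Fin 5 → V) (blk : E → Fin 5) (Vj : Fin 5 → Set V),
    Cycle.IsNecklace ends q blk Vj → ∀ ko k₁ k₂ k₃ kb : Fin 5, ko ≠ k₁ → ko ≠ k₂ → ko ≠ k₃ →
    ko ≠ kb → k₁ ≠ k₂ → k₁ ≠ k₃ → k₁ ≠ kb → k₂ ≠ k₃ → k₂ ≠ kb → k₃ ≠ kb →
    q ko = o → q k₁ = a₁ → q k₂ = a₂ → q k₃ = a₃ → q kb ≠ b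
  /-- not a block substitution of a skeleton on the five marks -/
  notFive : ¬ BlockSubst.FiveTerminalClass ends o a₁ a₂ a₃ b
  /-- not a block substitution of the 15-edge skeleton on the marks and one more terminal -/
  notSix : ¬ BlockSubst.SixTerminalClass ends o a₁ a₂ a₃ b
  /-- not a subgraph of a certified seven-vertex skeleton, marks in order -/
  notSeven : ¬ Seven.SevenSkelClass ends o a₁ a₂ a₃ b
  /-- not a subgraph of a certified seven-vertex skeleton, roots swapped -/
  notSeven' : ¬ Seven.SevenSkelClass ends o a₂ a₁ a₃ b
  /-- `a₁` is not isolated -/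
  notIso_a1 : ¬ IsolatedMark.IsIsolated ends a₁
  /-- `a₂` is not isolated -/
  notIso_a2 : ¬ IsolatedMark.IsIsolated ends a₂
  /-- `o` is not isolated -/
  notIso_o : ¬ IsolatedMark.IsIsolated ends o
  /-- `b` is not isolated -/
  notIso_b : ¬ IsolatedMark.IsIsolated ends b
  /-- two-connected off `a₃` -/
  whitney : WhitneyOff ends a₃

end Class

section CutClauses

variable {V : Type*} {E : Type*} [Fintype E] [DecidableEq V]
variable {ends : E → Sym2 V} {side : E → Bool} {L : Set V} {v : V} {Rt : Set V} {o a₁ a₂ a₃ b : V}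

/-- The marks `o, a₁, a₂, b` of a `WReducedW` instance lie on non-loop edges. -/
lemma mark_edge_of_wredW (h : WReducedW ends o a₁ a₂ a₃ b) {m : V}
    (hm : m = a₁ ∨ m = a₂ ∨ m = o ∨ m = b) : ∃ e, m ∈ ends e ∧ ¬ (ends e).IsDiag := by
  rcases hm with rfl | rfl | rfl | rfl
  · exact exists_edge_of_not_isolated h.notIso_a1
  · exact exists_edge_of_not_isolated h.notIso_a2
  · exact exists_edge_of_not_isolated h.notIso_o
  · exact exists_edge_of_not_isolated h.notIso_b

omit [DecidableEq V] in
/-- A mark among `o, a₁, a₂, b` is not `a₃`. -/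
lemma ne_a3_of_mark (h12 : a₁ ≠ a₂) (h13 : a₁ ≠ a₃) (h23 : a₂ ≠ a₃) (ho3 : o ≠ a₃)
    (hb3 : b ≠ a₃) {m : V} (hm : m = a₁ ∨ m = a₂ ∨ m = o ∨ m = b) : m ≠ a₃ := by
  have _ := h12
  rcases hm with rfl | rfl | rfl | rfl
  · exact h13
  · exact h23
  · exact ho3
  · exact hb3

/-- **No non-isolated vertex other than `a₃` is on the left** of a cut with a mark among
`o, a₁, a₂, b` on the right. -/
lemma not_left_of_wredW (h : WReducedW ends o a₁ a₂ a₃ b) (h12 : a₁ ≠ a₂) (h13 : a₁ ≠ a₃)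
    (h23 : a₂ ≠ a₃) (ho3 : o ≠ a₃) (hb3 : b ≠ a₃) (hcut : CutVertex ends side L v Rt) {m : V}
    (hm : m = a₁ ∨ m = a₂ ∨ m = o ∨ m = b) (hmR : m ∈ Rt) {x : V} (hx3 : x ≠ a₃)
    (hxE : ∃ e, x ∈ ends e ∧ ¬ (ends e).IsDiag) (hx : x ∈ L) : False :=
  not_left_of_whitney h.whitney hcut hmR (ne_a3_of_mark h12 h13 h23 ho3 hb3 hm)
    (mark_edge_of_wredW h hm) hx3 hxE hx

omit [DecidableEq V] in
/-- Of two distinct marks placed on the right or at `v`, one is on the right. -/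
lemma mark_right_of_two {m₁ m₂ : V} (h₁ : m₁ ∈ Rt ∨ m₁ = v) (h₂ : m₂ ∈ Rt ∨ m₂ = v)
    (hne : m₁ ≠ m₂) : m₁ ∈ Rt ∨ m₂ ∈ Rt := by
  rcases h₁ with h₁ | h₁
  · exact Or.inl h₁
  · rcases h₂ with h₂ | h₂
    · exact Or.inr h₂
    · exact absurd (h₁.trans h₂.symm) hne

/-- **`prune` from `WhitneyOff`**: a mark-free left side carries no non-loop edge. -/
lemma prune_of_whitney (h : WReducedW ends o a₁ a₂ a₃ b) (h12 : a₁ ≠ a₂) (h13 : a₁ ≠ a₃)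
    (h23 : a₂ ≠ a₃) (ho3 : o ≠ a₃) (hb3 : b ≠ a₃) (hcut : CutVertex ends side L v Rt) (g : E)
    (hM : ∀ m ∈ ({o, a₁, a₂, a₃, b} : Set V), m ∈ Rt ∨ m = v) (hg : side g = true) :
    (ends g).IsDiag := by
  by_contra hd
  obtain ⟨x, y, hxy, hxL, -⟩ := exists_left_end hcut hg hd
  have hx3 : x ≠ a₃ := by
    rintro rfl
    rcases hM x (by simp) with hR | hv
    · exact hcut.disj x hxL hR
    · exact hcut.vL (hv ▸ hxL)
  have hxE : ∃ e, x ∈ ends e ∧ ¬ (ends e).IsDiag :=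
    ⟨g, by rw [hxy]; exact Sym2.mem_mk_left _ _, hd⟩
  rcases mark_right_of_two (hM a₁ (by simp)) (hM a₂ (by simp)) h12 with hR | hR
  · exact not_left_of_wredW h h12 h13 h23 ho3 hb3 hcut (Or.inl rfl) hR hx3 hxE hxL
  · exact not_left_of_wredW h h12 h13 h23 ho3 hb3 hcut (Or.inr (Or.inl rfl)) hR hx3 hxE hxL

/-- With a mark among `o, a₁, a₂, b` on the right, every non-loop left edge is `{a₃, v}`. -/
lemma left_edge_eq_of_mark_right (h : WReducedW ends o a₁ a₂ a₃ b) (h12 : a₁ ≠ a₂)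
    (h13 : a₁ ≠ a₃) (h23 : a₂ ≠ a₃) (ho3 : o ≠ a₃) (hb3 : b ≠ a₃)
    (hcut : CutVertex ends side L v Rt) {m : V} (hm : m = a₁ ∨ m = a₂ ∨ m = o ∨ m = b)
    (hmR : m ∈ Rt) {g : E} (hg : side g = true) (hd : ¬ (ends g).IsDiag) : ends g = s(a₃, v) := by
  obtain ⟨x, y, hxy, hxL, hy⟩ := exists_left_end hcut hg hd
  have hne : x ≠ y := by
    rw [hxy, Sym2.mk_isDiag_iff] at hd
    exact hd
  have hx3 : x = a₃ := by
    by_contra hx3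
    exact not_left_of_wredW h h12 h13 h23 ho3 hb3 hcut hm hmR hx3
      ⟨g, by rw [hxy]; exact Sym2.mem_mk_left _ _, hd⟩ hxL
  subst hx3
  rcases hy with hyL | hyv
  · exfalso
    exact not_left_of_wredW h h12 h13 h23 ho3 hb3 hcut hm hmR hne.symm
      ⟨g, by rw [hxy]; exact Sym2.mem_mk_right _ _, hd⟩ hyL
  · rw [hxy, hyv]

/-- **`oneFar` from `WhitneyOff`**: a single far mark has at most one non-loop edge on its side. -/
lemma oneFar_of_whitney (h : WReducedW ends o a₁ a₂ a₃ b) (h12 : a₁ ≠ a₂) (h13 : a₁ ≠ a₃)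
    (h23 : a₂ ≠ a₃) (ho1 : o ≠ a₁) (ho2 : o ≠ a₂) (ho3 : o ≠ a₃) (hb1 : b ≠ a₁) (hb2 : b ≠ a₂)
    (hb3 : b ≠ a₃) (hcut : CutVertex ends side L v Rt) (w : V) (_hw : w ∈ L)
    (hM : ∀ m ∈ ({o, a₁, a₂, a₃, b} : Set V), m = w ∨ m ∈ Rt ∨ m = v) :
    leftCard ends side ≤ 1 := by
  -- a mark among `o, a₁, a₂, b` on the right
  have hR : ∃ m, (m = a₁ ∨ m = a₂ ∨ m = o ∨ m = b) ∧ m ∈ Rt := by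
    have key : ∀ m₁ m₂ : V, (m₁ = a₁ ∨ m₁ = a₂ ∨ m₁ = o ∨ m₁ = b) →
        (m₂ = a₁ ∨ m₂ = a₂ ∨ m₂ = o ∨ m₂ = b) → m₁ ≠ m₂ → m₁ ≠ w → m₂ ≠ w →
        m₁ ∈ ({o, a₁, a₂, a₃, b} : Set V) → m₂ ∈ ({o, a₁, a₂, a₃, b} : Set V) →
        ∃ m, (m = a₁ ∨ m = a₂ ∨ m = o ∨ m = b) ∧ m ∈ Rt := by
      intro m₁ m₂ hm₁ hm₂ hne h₁w h₂w h₁M h₂M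
      have h₁ : m₁ ∈ Rt ∨ m₁ = v := (hM m₁ h₁M).resolve_left h₁w
      have h₂ : m₂ ∈ Rt ∨ m₂ = v := (hM m₂ h₂M).resolve_left h₂w
      rcases mark_right_of_two h₁ h₂ hne with hR | hR
      · exact ⟨m₁, hm₁, hR⟩
      · exact ⟨m₂, hm₂, hR⟩
    by_cases hw1 : w = a₁
    · subst hw1
      exact key a₂ o (Or.inr (Or.inl rfl)) (Or.inr (Or.inr (Or.inl rfl))) ho2.symm h12.symm ho1
        (by simp) (by simp)
    by_cases hw2 : w = a₂
    · subst hw2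
      exact key a₁ o (Or.inl rfl) (Or.inr (Or.inr (Or.inl rfl))) ho1.symm h12 ho2 (by simp)
        (by simp)
    exact key a₁ a₂ (Or.inl rfl) (Or.inr (Or.inl rfl)) h12 (Ne.symm hw1) (Ne.symm hw2) (by simp)
      (by simp)
  obtain ⟨m, hm, hmR⟩ := hR
  rw [leftCard, Finset.card_le_one]
  intro g₁ hg₁ g₂ hg₂
  rw [Finset.mem_filter] at hg₁ hg₂
  by_contra hne
  exact h.simple g₁ g₂ hne hg₁.2.2
    ((left_edge_eq_of_mark_right h h12 h13 h23 ho3 hb3 hcut hm hmR hg₁.2.1 hg₁.2.2).trans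
      (left_edge_eq_of_mark_right h h12 h13 h23 ho3 hb3 hcut hm hmR hg₂.2.1 hg₂.2.2).symm)

end CutClauses

end WRed

end Summit.Ventures.PercRepro2
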